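import Literature.Topology.FourManifolds.MMSWPictureOuterChart
import Literature.Topology.FourManifolds.MMSWRasmussenGeneralPosition
import Mathlib.Analysis.SpecialFunctions.Sqrt
import HarnessLib

/-!
# The outer band of the standard picture: level curves are transverse to the outer chart

Topic `Literature/Topology/FourManifolds`; part of the proof of the named fact
`Literature.Topology.FourManifolds.pictureSurgeryPresentation` (`MMSWPictureSurgery.lean`; Kirby,
*The Topology of 4-Manifolds*, LNM 1374 (1989), Ch. I §2, Lemma 2.1).  Everything here is proved;
no named fact is introduced.

In the coordinates `(e, s)` of `MMSWPictureOuterChart` (`e` the direction of the co-latitude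
vector, `s` the latitude; inverse parametrisation `outerZ k e s` of the planar half-plane) the
outer boundary curve `Γ_out = {g_k = 1, |z| ≈ R'_k}` of the planar domain of the model boundary
`M_k` lies in the thin band `s ∈ [c, c + 1/100]`, `c = latC k = a/C_k` (`latS_mem_of_far`), and on
the wider band `outerBand k = [c − 1/50, c + 1/50]` the planar potential is strictly decreasing
along every meridian `s ↦ outerZ k e s`, with derivative `≤ −2`
(`exists_hasDerivAt_planarPot_outerZ`).  The computation rests on the exact formulas
`|Z|² = R'² + 2a(a − Cs)/(1 − √(1 − s²) e₁)` (`normSq_outerZ`) and `|∂_s Z| = a/(√(1 − s²)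
(1 − √(1 − s²) e₁))` (`deriv_outerZ_normSq`), and on the remoteness of the band from the holes
(`norm_outerZ_sub_holeCentre_ge`).  These are the transversality facts that make the outer
compression of the picture (pushing the collar of the outer core of `M_k` onto a neighbourhood
of the axis of the picture) a diffeomorphism.

## References

* R. Kirby, *The Topology of 4-Manifolds*, LNM 1374 (1989), Ch. I §2. [Kirby1989]
* C. Manolescu, M. Marengon, S. Sarkar, M. Willis, Duke Math. J. 172 (2023), Def. 8.26,
  Remark 8.27. [ManolescuMarengonSarkarWillis2023]
-/

open scoped Manifold ContDiff Topology Real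
open Function Set

noncomputable section

namespace Literature.Topology.FourManifolds

/-- Local notation: `𝔼 n` is the model Euclidean space `EuclideanSpace ℝ (Fin n)`. -/
local notation "𝔼 " n:arg => EuclideanSpace ℝ (Fin n)

namespace MMSW

open Literature.AlgebraicTopology.Homotopy.HopfFibration (zC wC)

variable {k : ℕ}

/-! ## The critical latitude `c = a / C_k` and the outer band -/

/-- **The critical latitude** `c_k = a / C_k`: the revolved circle `|z| = R'_k` is the latitude
torus `s = c_k` of the outer chart (`normSq_le_bigRadius_sq_iff`). [folklore] -/
def latC (k : ℕ) : ℝ := focal k / drawRadius k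

/-- `C_k > 0`. [folklore] -/
theorem drawRadius_pos' : 0 < drawRadius k := by unfold drawRadius; positivity

/-- `C_k c_k = a`. [folklore] -/
theorem drawRadius_mul_latC : drawRadius k * latC k = focal k := by
  rw [latC, mul_div_cancel₀ _ drawRadius_pos'.ne']

/-- `c_k > 91/100`. [folklore] -/
theorem lt_latC : 91 / 100 < latC k := by
  rw [latC, lt_div_iff₀ drawRadius_pos']
  have := lt_focal (k := k)
  unfold drawRadius
  linarith

/-- `c_k < 23/25`. [folklore] -/
theorem latC_lt : latC k < 23 / 25 := by
  rw [latC, div_lt_iff₀ drawRadius_pos']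
  have := focal_lt (k := k)
  unfold drawRadius
  linarith

/-- `|z| ≤ R'_k` iff `c_k ≤ s_k(z)`. [folklore] -/
theorem normSq_le_bigRadius_sq_iff_latC (z : ℂ) :
    Complex.normSq z ≤ bigRadius k ^ 2 ↔ latC k ≤ latS k z := by
  rw [normSq_le_bigRadius_sq_iff, ← drawRadius_mul_latC]
  have hC := drawRadius_pos' (k := k)
  constructor
  · intro h; nlinarith
  · intro h; nlinarith

/-- **The outer band** `[c_k − 1/50, c_k + 1/50]` of latitudes. [folklore] -/
def outerBand (k : ℕ) : Set ℝ := Icc (latC k - 1 / 50) (latC k + 1 / 50)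

variable {s : ℝ} {e : 𝔼 2}

/-- Numerical bounds on the band: `89/100 ≤ s ≤ 47/50`. [folklore] -/
theorem outerBand_bounds (hs : s ∈ outerBand k) : 89 / 100 ≤ s ∧ s ≤ 47 / 50 := by
  have h1 := lt_latC (k := k)
  have h2 := latC_lt (k := k)
  exact ⟨by linarith [hs.1], by linarith [hs.2]⟩

/-- `s > 0` on the band. [folklore] -/
theorem outerBand_pos (hs : s ∈ outerBand k) : 0 < s := by
  linarith [(outerBand_bounds hs).1]

/-- `s < 1` on the band. [folklore] -/
theorem outerBand_lt_one (hs : s ∈ outerBand k) : s < 1 := by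
  linarith [(outerBand_bounds hs).2]

/-- `|a − C_k s| ≤ C_k/50` on the band. [folklore] -/
theorem abs_focal_sub_le (hs : s ∈ outerBand k) : |focal k - drawRadius k * s| ≤ drawRadius k / 50 := by
  rw [← drawRadius_mul_latC, ← mul_sub, abs_mul, abs_of_pos drawRadius_pos']
  have h : |latC k - s| ≤ 1 / 50 := abs_sub_le_iff.2 ⟨by linarith [hs.1], by linarith [hs.2]⟩
  have hC := drawRadius_pos' (k := k)
  calc drawRadius k * |latC k - s| ≤ drawRadius k * (1 / 50) := by gcongr
    _ = drawRadius k / 50 := by ring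

/-- `1/3 ≤ √(1 − s²) ≤ 1/2` on the band. [folklore] -/
theorem sqrt_one_sub_sq_bounds (hs : s ∈ outerBand k) :
    1 / 3 ≤ Real.sqrt (1 - s ^ 2) ∧ Real.sqrt (1 - s ^ 2) ≤ 1 / 2 := by
  obtain ⟨h1, h2⟩ := outerBand_bounds hs
  constructor
  · calc (1 : ℝ) / 3 = Real.sqrt ((1 / 3) ^ 2) := (Real.sqrt_sq (by norm_num)).symm
      _ ≤ Real.sqrt (1 - s ^ 2) := Real.sqrt_le_sqrt (by nlinarith)
  · calc Real.sqrt (1 - s ^ 2) ≤ Real.sqrt ((1 / 2) ^ 2) := Real.sqrt_le_sqrt (by nlinarith)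
      _ = 1 / 2 := Real.sqrt_sq (by norm_num)

/-- A coordinate of a unit vector of `ℝ²` is at most `1` in absolute value. [folklore] -/
theorem abs_apply_le_one_of_norm_eq_one (he : ‖e‖ = 1) (i : Fin 2) : |e i| ≤ 1 := by
  have hi : e i ^ 2 ≤ ‖e‖ ^ 2 := by
    rw [EuclideanSpace.norm_eq, Real.sq_sqrt (by positivity)]
    have h : e i ^ 2 = ‖e i‖ ^ 2 := by rw [Real.norm_eq_abs, sq_abs]
    rw [h]
    exact Finset.single_le_sum (f := fun j ↦ ‖e j‖ ^ 2) (fun j _ ↦ by positivity) (Finset.mem_univ i)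
  rw [he, one_pow] at hi
  rw [abs_le]
  constructor <;> nlinarith [hi]

/-- `1/2 ≤ 1 − √(1 − s²) e₁ ≤ 3/2` on the band. [folklore] -/
theorem one_sub_sqrt_mul_bounds (he : ‖e‖ = 1) (hs : s ∈ outerBand k) :
    1 / 2 ≤ 1 - Real.sqrt (1 - s ^ 2) * e 1 ∧ 1 - Real.sqrt (1 - s ^ 2) * e 1 ≤ 3 / 2 := by
  obtain ⟨h1, h2⟩ := sqrt_one_sub_sq_bounds hs
  have he1 := abs_le.1 (abs_apply_le_one_of_norm_eq_one he 1)
  constructor <;> nlinarith [he1.1, he1.2]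

/-! ## The band points are far from the holes -/

/-- **Lower bound** `|Z_k(e, s)|² ≥ 864(k+1)²` on the band. [folklore] -/
theorem le_normSq_outerZ (he : ‖e‖ = 1) (hs : s ∈ outerBand k) :
    864 * ((k : ℝ) + 1) ^ 2 ≤ Complex.normSq (outerZ k e s) := by
  rw [normSq_outerZ he (outerBand_pos hs) (outerBand_lt_one hs).le]
  obtain ⟨hD1, hD2⟩ := one_sub_sqrt_mul_bounds he hs
  have hab := abs_le.1 (abs_focal_sub_le hs)
  have ha1 := lt_focal (k := k)
  have ha2 := focal_lt (k := k)
  have hk : (0 : ℝ) ≤ k := Nat.cast_nonneg k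
  -- `2a(a - Cs)/D ≥ -2a (C/50) / (1/2)`
  have ha0 := focal_pos (k := k)
  have hC : 0 ≤ drawRadius k := drawRadius_pos'.le
  have hlow : -(4 * focal k * (drawRadius k / 50)) ≤
      2 * focal k * (focal k - drawRadius k * s) / (1 - Real.sqrt (1 - s ^ 2) * e 1) := by
    rw [le_div_iff₀ (by linarith)]
    nlinarith [mul_nonneg ha0.le (by linarith [hab.1] : (0:ℝ) ≤ focal k - drawRadius k * s + drawRadius k / 50),
      mul_nonneg (mul_nonneg ha0.le hC) (by linarith : (0:ℝ) ≤ 1 - Real.sqrt (1 - s ^ 2) * e 1 - 1 / 2)]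
  have hk1 : (0 : ℝ) ≤ (k : ℝ) + 1 := by positivity
  have h8 : focal k * (drawRadius k / 50) ≤ 92 * ((k : ℝ) + 1) * (2 * ((k : ℝ) + 1)) := by
    have h9 : drawRadius k / 50 = 2 * ((k : ℝ) + 1) := by unfold drawRadius; ring
    rw [h9]
    exact mul_le_mul_of_nonneg_right ha2.le (by positivity)
  unfold bigRadius
  nlinarith [hlow, h8]

/-- **The band lies in the far zone**: `|Z_k(e, s)| ≥ 29(k+1)`. [folklore] -/
theorem le_norm_outerZ (he : ‖e‖ = 1) (hs : s ∈ outerBand k) :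
    29 * ((k : ℝ) + 1) ≤ ‖outerZ k e s‖ := by
  have h := le_normSq_outerZ he hs
  rw [Complex.normSq_eq_norm_sq] at h
  have hk : (0 : ℝ) ≤ 29 * ((k : ℝ) + 1) := by positivity
  nlinarith [norm_nonneg (outerZ k e s)]

/-- **The band is far from every hole**: `|Z_k(e, s) − c_j| ≥ 25(k+1)`. [folklore] -/
theorem norm_outerZ_sub_holeCentre_ge (he : ‖e‖ = 1) (hs : s ∈ outerBand k) (j : Fin k) :
    25 * ((k : ℝ) + 1) ≤ ‖outerZ k e s - holeCentre k j‖ := by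
  have h1 := le_norm_outerZ he hs
  have h2 := norm_holeCentre_le (r := k) j
  have h3 := norm_sub_norm_le (outerZ k e s) (holeCentre k j)
  linarith

/-- Below the critical latitude the meridian point lies outside the disc `|z| ≤ R'_k`
(so that its potential exceeds `1`). [folklore] -/
theorem bigRadius_sq_lt_normSq_outerZ (he : ‖e‖ = 1) (hs0 : 0 < s) (hs : s < latC k) :
    bigRadius k ^ 2 < Complex.normSq (outerZ k e s) := by
  have hs1 : s ≤ 1 := by linarith [latC_lt (k := k)]
  rw [normSq_outerZ he hs0 hs1]
  have hD := one_sub_sqrt_mul_pos hs0 he.le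
  have h : 0 < focal k - drawRadius k * s := by
    rw [← drawRadius_mul_latC, ← mul_sub]
    exact mul_pos drawRadius_pos' (by linarith)
  have := focal_pos (k := k)
  have h2 : 0 < 2 * focal k * (focal k - drawRadius k * s) / (1 - Real.sqrt (1 - s ^ 2) * e 1) := by
    positivity
  linarith

/-- Below the critical latitude the potential of the meridian point exceeds `1`. [folklore] -/
theorem one_lt_planarPot_outerZ (he : ‖e‖ = 1) (hs0 : 0 < s) (hs : s < latC k) :
    1 < planarPot k (outerZ k e s) := by
  have h := bigRadius_sq_lt_normSq_outerZ he hs0 hs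
  rw [planarPot_eq_bigRadius]
  have hsum : 0 ≤ ∑ j : Fin k, 1 / Complex.normSq (outerZ k e s - holeCentre k j) :=
    Finset.sum_nonneg fun j _ ↦ one_div_nonneg.2 (Complex.normSq_nonneg _)
  have hR := bigRadius_pos (k := k)
  have h1 : 1 < Complex.normSq (outerZ k e s) / bigRadius k ^ 2 := by
    rw [one_lt_div (by positivity)]; exact h
  linarith

/-! ## The latitude of the far part of the planar domain -/

/-- On the far zone `|z| ≥ 20(k+1)` the hole sum is at most `1/1000`. [folklore] -/
theorem sum_inv_normSq_le_of_far {z : ℂ} (hz : 20 * ((k : ℝ) + 1) ≤ ‖z‖) :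
    ∑ j : Fin k, 1 / Complex.normSq (z - holeCentre k j) ≤ 1 / 1000 := by
  have hk : (0 : ℝ) ≤ k := Nat.cast_nonneg k
  have hterm : ∀ j : Fin k, 1 / Complex.normSq (z - holeCentre k j) ≤
      1 / (16 * ((k : ℝ) + 1)) ^ 2 := fun j ↦ by
    have h2 := norm_holeCentre_le (r := k) j
    have h3 := norm_sub_norm_le z (holeCentre k j)
    have hd : 16 * ((k : ℝ) + 1) ≤ ‖z - holeCentre k j‖ := by linarith
    rw [Complex.normSq_eq_norm_sq]
    apply one_div_le_one_div_of_le (by positivity)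
    exact pow_le_pow_left₀ (by positivity) hd 2
  calc ∑ j : Fin k, 1 / Complex.normSq (z - holeCentre k j)
      ≤ ∑ _j : Fin k, 1 / (16 * ((k : ℝ) + 1)) ^ 2 := Finset.sum_le_sum fun j _ ↦ hterm j
    _ = k / (16 * ((k : ℝ) + 1)) ^ 2 := by
      rw [Finset.sum_const, Finset.card_univ, Fintype.card_fin, nsmul_eq_mul, mul_one_div]
    _ ≤ 1 / 1000 := by
      rw [div_le_div_iff₀ (by positivity) (by positivity)]
      nlinarith [sq_nonneg ((k : ℝ) - 1)]

/-- **The latitude of the far part of `{19/20 ≤ g_k ≤ 1}`**: a planar point with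
`|z| ≥ 20(k+1)` and `19/20 ≤ g_k(z) ≤ 1` has latitude in `[c_k, c_k + 1/100]`. [folklore] -/
theorem latS_mem_of_far {z : ℂ} (hz : 20 * ((k : ℝ) + 1) ≤ ‖z‖) (hg1 : planarPot k z ≤ 1)
    (hg2 : 19 / 20 ≤ planarPot k z) : latC k ≤ latS k z ∧ latS k z ≤ latC k + 1 / 100 := by
  have hsum := sum_inv_normSq_le_of_far hz
  have hsum0 : 0 ≤ ∑ j : Fin k, 1 / Complex.normSq (z - holeCentre k j) :=
    Finset.sum_nonneg fun j _ ↦ one_div_nonneg.2 (Complex.normSq_nonneg _)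
  rw [planarPot_eq_bigRadius] at hg1 hg2
  have hR := bigRadius_pos (k := k)
  have hR2 : 0 < bigRadius k ^ 2 := by positivity
  constructor
  · rw [← normSq_le_bigRadius_sq_iff_latC]
    have h1 : Complex.normSq z / bigRadius k ^ 2 ≤ 1 := by linarith
    rwa [div_le_one hR2] at h1
  · -- `|z|² ≥ 0.949 R'²`, so `(a - Cs)Σ/a ≥ -0.051 R'²`, `Σ ≥ a²`
    have h1 : 949 / 1000 ≤ Complex.normSq z / bigRadius k ^ 2 := by linarith
    rw [le_div_iff₀ hR2] at h1
    have hid := normSq_sub_bigRadius_sq (k := k) z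
    have ha := focal_pos (k := k)
    have ha1 := lt_focal (k := k)
    have hS : focal k ^ 2 ≤ outerDen k z := by
      unfold outerDen; nlinarith [sq_nonneg (z.re + drawRadius k), sq_nonneg z.im]
    have hSpos := outerDen_pos (k := k) z
    -- `(Cs - a) Σ ≤ 0.051 R'² a`
    have h2 : (drawRadius k * latS k z - focal k) * outerDen k z ≤ 51 / 1000 * bigRadius k ^ 2 * focal k := by
      have : (focal k - drawRadius k * latS k z) * outerDen k z / focal k ≥ -(51 / 1000 * bigRadius k ^ 2) := by
        linarith
      rw [ge_iff_le, le_div_iff₀ ha] at this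
      linarith
    by_contra hlt
    push Not at hlt
    -- then `Cs - a > C/100`
    have h3 : drawRadius k / 100 < drawRadius k * latS k z - focal k := by
      rw [← drawRadius_mul_latC]
      have hC := drawRadius_pos' (k := k)
      nlinarith
    have h4 : drawRadius k / 100 * focal k ^ 2 < 51 / 1000 * bigRadius k ^ 2 * focal k := by
      calc drawRadius k / 100 * focal k ^ 2 ≤ drawRadius k / 100 * outerDen k z := by
            have hC := drawRadius_pos' (k := k); gcongr
        _ < (drawRadius k * latS k z - focal k) * outerDen k z := by gcongr
        _ ≤ _ := h2
    unfold drawRadius bigRadius at h4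
    have hk1 : (0 : ℝ) < (k : ℝ) + 1 := by positivity
    have h5 : focal k * ((k : ℝ) + 1) * (focal k - 816 / 10 * ((k : ℝ) + 1)) < 0 := by linarith [h4]
    have h6 : 0 < focal k - 816 / 10 * ((k : ℝ) + 1) := by linarith
    have h7 := mul_pos (mul_pos ha hk1) h6
    linarith

/-! ## Derivatives along the meridians -/

/-- `d/ds √(1 − s²) = −s/√(1 − s²)` for `s² < 1`. [folklore] -/
theorem hasDerivAt_sqrt_one_sub_sq (hs : s ^ 2 < 1) :
    HasDerivAt (fun s : ℝ ↦ Real.sqrt (1 - s ^ 2)) (-s / Real.sqrt (1 - s ^ 2)) s := by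
  have h : HasDerivAt (fun s : ℝ ↦ 1 - s ^ 2) (-(2 * s)) s := by
    have := (hasDerivAt_pow 2 s).const_sub 1
    simpa using this
  have hne : 1 - s ^ 2 ≠ 0 := by linarith
  convert h.sqrt hne using 1
  have hpos : 0 < Real.sqrt (1 - s ^ 2) := Real.sqrt_pos.2 (by linarith)
  field_simp

/-- `d/ds (1 − √(1 − s²) e₁) = s e₁/√(1 − s²)`. [folklore] -/
theorem hasDerivAt_one_sub_sqrt_mul (hs : s ^ 2 < 1) (e1 : ℝ) :
    HasDerivAt (fun s : ℝ ↦ 1 - Real.sqrt (1 - s ^ 2) * e1) (s * e1 / Real.sqrt (1 - s ^ 2)) s := by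
  refine (((hasDerivAt_sqrt_one_sub_sq hs).mul_const e1).const_sub 1).congr_deriv ?_
  ring

/-- **The derivative of `Re Z_k(e, s)`**: `a(√(1 − s²) − e₁)/(√(1 − s²) D²)`,
`D = 1 − √(1 − s²) e₁`. [folklore] -/
theorem hasDerivAt_outerZ_re (he : ‖e‖ ≤ 1) (hs0 : 0 < s) (hs1 : s < 1) :
    HasDerivAt (fun s : ℝ ↦ (outerZ k e s).re)
      (focal k * (Real.sqrt (1 - s ^ 2) - e 1) /
        (Real.sqrt (1 - s ^ 2) * (1 - Real.sqrt (1 - s ^ 2) * e 1) ^ 2)) s := by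
  have hs : s ^ 2 < 1 := by nlinarith
  have hT : 0 < Real.sqrt (1 - s ^ 2) := Real.sqrt_pos.2 (by nlinarith)
  have hT2 : Real.sqrt (1 - s ^ 2) ^ 2 = 1 - s ^ 2 := Real.sq_sqrt (by nlinarith)
  have hD := one_sub_sqrt_mul_pos hs0 he
  have hnum : HasDerivAt (fun s : ℝ ↦ focal k * s) (focal k * 1) s := (hasDerivAt_id s).const_mul _
  have h := (hnum.div (hasDerivAt_one_sub_sqrt_mul hs (e 1)) hD.ne').sub_const (drawRadius k)
  simp only [outerZ_re]
  refine h.congr_deriv ?_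
  rw [div_eq_div_iff (pow_ne_zero 2 hD.ne') (mul_ne_zero hT.ne' (pow_ne_zero 2 hD.ne'))]
  field_simp
  linear_combination (-(focal k * e 1 * (1 - Real.sqrt (1 - s ^ 2) * e 1) ^ 2) -
    focal k * e 1 ^ 2 * Real.sqrt (1 - s ^ 2) * (2 - Real.sqrt (1 - s ^ 2) * e 1)) * hT2

/-- **The derivative of `Im Z_k(e, s)`**: `−a e₀ s/(√(1 − s²) D²)`. [folklore] -/
theorem hasDerivAt_outerZ_im (he : ‖e‖ ≤ 1) (hs0 : 0 < s) (hs1 : s < 1) :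
    HasDerivAt (fun s : ℝ ↦ (outerZ k e s).im)
      (-(focal k * e 0 * s) / (Real.sqrt (1 - s ^ 2) * (1 - Real.sqrt (1 - s ^ 2) * e 1) ^ 2)) s := by
  have hs : s ^ 2 < 1 := by nlinarith
  have hT : 0 < Real.sqrt (1 - s ^ 2) := Real.sqrt_pos.2 (by nlinarith)
  have hT2 : Real.sqrt (1 - s ^ 2) ^ 2 = 1 - s ^ 2 := Real.sq_sqrt (by nlinarith)
  have hD := one_sub_sqrt_mul_pos hs0 he
  have hnum : HasDerivAt (fun s : ℝ ↦ focal k * Real.sqrt (1 - s ^ 2) * e 0)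
      (focal k * (-s / Real.sqrt (1 - s ^ 2)) * e 0) s :=
    ((hasDerivAt_sqrt_one_sub_sq hs).const_mul (focal k)).mul_const (e 0)
  have h := hnum.div (hasDerivAt_one_sub_sqrt_mul hs (e 1)) hD.ne'
  simp only [outerZ_im]
  refine h.congr_deriv ?_
  rw [div_eq_div_iff (pow_ne_zero 2 hD.ne') (mul_ne_zero hT.ne' (pow_ne_zero 2 hD.ne'))]
  field_simp
  ring

/-- **The exact speed of the meridians**: `|∂_s Z|² = a²/((1 − s²) D²)`. [folklore] -/
theorem deriv_outerZ_normSq (he : ‖e‖ = 1) (hs0 : 0 < s) (hs1 : s < 1) :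
    (focal k * (Real.sqrt (1 - s ^ 2) - e 1) /
        (Real.sqrt (1 - s ^ 2) * (1 - Real.sqrt (1 - s ^ 2) * e 1) ^ 2)) ^ 2 +
      (-(focal k * e 0 * s) / (Real.sqrt (1 - s ^ 2) * (1 - Real.sqrt (1 - s ^ 2) * e 1) ^ 2)) ^ 2 =
      focal k ^ 2 / (Real.sqrt (1 - s ^ 2) ^ 2 * (1 - Real.sqrt (1 - s ^ 2) * e 1) ^ 2) := by
  have hT : 0 < Real.sqrt (1 - s ^ 2) := Real.sqrt_pos.2 (by nlinarith)
  have hT2 : Real.sqrt (1 - s ^ 2) ^ 2 = 1 - s ^ 2 := Real.sq_sqrt (by nlinarith)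
  have hD := one_sub_sqrt_mul_pos hs0 he.le
  have he2 : e 0 ^ 2 + e 1 ^ 2 = 1 := by rw [← norm_sq_eq_of_fin_two, he, one_pow]
  have hden1 : (Real.sqrt (1 - s ^ 2) * (1 - Real.sqrt (1 - s ^ 2) * e 1) ^ 2) ^ 2 ≠ 0 :=
    pow_ne_zero 2 (mul_ne_zero hT.ne' (pow_ne_zero 2 hD.ne'))
  have hden2 : Real.sqrt (1 - s ^ 2) ^ 2 * (1 - Real.sqrt (1 - s ^ 2) * e 1) ^ 2 ≠ 0 :=
    mul_ne_zero (pow_ne_zero 2 hT.ne') (pow_ne_zero 2 hD.ne')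
  rw [div_pow, div_pow, ← add_div, div_eq_div_iff hden1 hden2]
  -- `(T - e₁)² + e₀² s² = D²`
  have key : (Real.sqrt (1 - s ^ 2) - e 1) ^ 2 + e 0 ^ 2 * s ^ 2 =
      (1 - Real.sqrt (1 - s ^ 2) * e 1) ^ 2 := by
    linear_combination (s ^ 2) * he2 + (1 - e 1 ^ 2) * hT2
  linear_combination (focal k ^ 2 * Real.sqrt (1 - s ^ 2) ^ 2 *
    (1 - Real.sqrt (1 - s ^ 2) * e 1) ^ 2) * key

/-- **The derivative of `|Z_k(e, s)|²`**: `2a(−C_k D − (a − C_k s) s e₁/√(1 − s²))/D²`. [folklore] -/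
theorem hasDerivAt_normSq_outerZ (he : ‖e‖ = 1) (hs0 : 0 < s) (hs1 : s < 1) :
    HasDerivAt (fun s : ℝ ↦ Complex.normSq (outerZ k e s))
      (2 * focal k * (-drawRadius k * (1 - Real.sqrt (1 - s ^ 2) * e 1) -
        (focal k - drawRadius k * s) * (s * e 1 / Real.sqrt (1 - s ^ 2))) /
        (1 - Real.sqrt (1 - s ^ 2) * e 1) ^ 2) s := by
  have hs : s ^ 2 < 1 := by nlinarith
  have hD := one_sub_sqrt_mul_pos hs0 he.le
  -- the closed form holds on a neighbourhood of `s`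
  have heq : (fun s : ℝ ↦ bigRadius k ^ 2 +
      2 * focal k * ((focal k - drawRadius k * s) / (1 - Real.sqrt (1 - s ^ 2) * e 1))) =ᶠ[𝓝 s]
      fun s : ℝ ↦ Complex.normSq (outerZ k e s) := by
    filter_upwards [Ioo_mem_nhds hs0 hs1] with s' hs'
    rw [normSq_outerZ he hs'.1 hs'.2.le, mul_div_assoc]
  have hnum : HasDerivAt (fun s : ℝ ↦ focal k - drawRadius k * s) (-(drawRadius k * 1)) s :=
    ((hasDerivAt_id s).const_mul _).const_sub _
  have h := ((hnum.div (hasDerivAt_one_sub_sqrt_mul hs (e 1)) hD.ne').const_mul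
    (2 * focal k)).const_add (bigRadius k ^ 2)
  refine (h.congr_of_eventuallyEq heq.symm).congr_deriv ?_
  rw [mul_div_assoc]
  ring

/-- **Cauchy–Schwarz in `ℝ²`.** [folklore] -/
theorem sq_inner_two_le (a b c d : ℝ) : (2 * a * c + 2 * b * d) ^ 2 ≤ 4 * (a ^ 2 + b ^ 2) * (c ^ 2 + d ^ 2) := by
  nlinarith [sq_nonneg (a * d - b * c)]

/-- **The derivative of a hole term along a meridian** and its bound
`|∂_s |Z − c_j|⁻²| ≤ 12a/(25(k+1))³` on the band. [folklore] -/
theorem exists_hasDerivAt_inv_normSq_outerZ (he : ‖e‖ = 1) (hs : s ∈ outerBand k) (j : Fin k) :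
    ∃ d : ℝ, HasDerivAt (fun s : ℝ ↦ 1 / Complex.normSq (outerZ k e s - holeCentre k j)) d s ∧
      |d| ≤ 12 * focal k / (25 * ((k : ℝ) + 1)) ^ 3 := by
  have hs0 := outerBand_pos hs
  have hs1 := outerBand_lt_one hs
  obtain ⟨hT1, hT2⟩ := sqrt_one_sub_sq_bounds hs
  obtain ⟨hD1, hD2⟩ := one_sub_sqrt_mul_bounds he hs
  set T := Real.sqrt (1 - s ^ 2) with hT
  set D := 1 - T * e 1 with hDdef
  set X' := focal k * (T - e 1) / (T * D ^ 2) with hX'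
  set Y' := -(focal k * e 0 * s) / (T * D ^ 2) with hY'
  have hX := hasDerivAt_outerZ_re (k := k) he.le hs0 hs1
  have hY := hasDerivAt_outerZ_im (k := k) he.le hs0 hs1
  rw [← hT, ← hDdef, ← hX'] at hX
  rw [← hT, ← hDdef, ← hY'] at hY
  -- the hole term `N = (X - c)² + Y²`
  set c : ℝ := 4 * (((j : ℕ) : ℝ) + 1) with hc
  have hN : ∀ s' : ℝ, Complex.normSq (outerZ k e s' - holeCentre k j) =
      ((outerZ k e s').re - c) * ((outerZ k e s').re - c) +
        (outerZ k e s').im * (outerZ k e s').im := fun s' ↦ by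
    rw [Complex.normSq_apply, Complex.sub_re, Complex.sub_im, holeCentre_re, holeCentre_im,
      sub_zero, ← hc]
  have hNd : HasDerivAt (fun s' : ℝ ↦ Complex.normSq (outerZ k e s' - holeCentre k j))
      (2 * ((outerZ k e s).re - c) * X' + 2 * (outerZ k e s).im * Y') s := by
    simp_rw [hN]
    exact (((hX.sub_const c).mul (hX.sub_const c)).add (hY.mul hY)).congr_deriv (by ring)
  -- positivity of `N` (band is far from the holes)
  have hm := norm_outerZ_sub_holeCentre_ge he hs j
  have hm0 : (0 : ℝ) < 25 * ((k : ℝ) + 1) := by positivity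
  have hNpos : (25 * ((k : ℝ) + 1)) ^ 2 ≤ Complex.normSq (outerZ k e s - holeCentre k j) := by
    rw [Complex.normSq_eq_norm_sq]
    exact pow_le_pow_left₀ hm0.le hm 2
  have hNpos' : 0 < Complex.normSq (outerZ k e s - holeCentre k j) := lt_of_lt_of_le (by positivity) hNpos
  have hN0 : Complex.normSq (outerZ k e s - holeCentre k j) ≠ 0 := hNpos'.ne'
  set N := Complex.normSq (outerZ k e s - holeCentre k j) with hNdef
  have hNn : 0 ≤ N := hNpos'.le
  set N' := 2 * ((outerZ k e s).re - c) * X' + 2 * (outerZ k e s).im * Y' with hN'def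
  refine ⟨(0 * N - 1 * N') / N ^ 2, (hasDerivAt_const s (1 : ℝ)).div hNd hN0, ?_⟩
  -- `|Z'|² = a²/(T² D²) ≤ 36 a²`
  have hZ' : X' ^ 2 + Y' ^ 2 = focal k ^ 2 / (T ^ 2 * D ^ 2) :=
    deriv_outerZ_normSq he hs0 hs1
  have hZ'le : X' ^ 2 + Y' ^ 2 ≤ 36 * focal k ^ 2 := by
    rw [hZ', div_le_iff₀ (by positivity)]
    have h1 : (1 : ℝ) / 36 ≤ T ^ 2 * D ^ 2 := by nlinarith [mul_le_mul hT1 hD1 (by norm_num) (by linarith)]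
    nlinarith [sq_nonneg (focal k)]
  -- Cauchy–Schwarz: `N'² ≤ 4 N |Z'|² ≤ 144 a² N`
  have hCS : N' ^ 2 ≤ 144 * focal k ^ 2 * N := by
    have h1 := sq_inner_two_le ((outerZ k e s).re - c) (outerZ k e s).im X' Y'
    rw [sq ((outerZ k e s).re - c), sq (outerZ k e s).im, ← hN s] at h1
    nlinarith [mul_le_mul_of_nonneg_left hZ'le (by linarith : (0:ℝ) ≤ 4 * N)]
  -- hence `|N'| m ≤ 12 a N` and `|N'|/N² ≤ 12 a/m³`
  have ha := focal_pos (k := k)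
  have h12 : 0 ≤ 12 * focal k * N := mul_nonneg (by positivity) hNn
  have hNm : |N'| * (25 * ((k : ℝ) + 1)) ≤ 12 * focal k * N := by
    rw [← sq_le_sq₀ (by positivity) h12]
    calc (|N'| * (25 * ((k : ℝ) + 1))) ^ 2 = N' ^ 2 * (25 * ((k : ℝ) + 1)) ^ 2 := by
          rw [mul_pow, sq_abs]
      _ ≤ (144 * focal k ^ 2 * N) * N :=
          mul_le_mul hCS hNpos (by positivity) (mul_nonneg (by positivity) hNn)
      _ = (12 * focal k * N) ^ 2 := by ring
  rw [zero_mul, zero_sub, one_mul, abs_div, abs_neg, abs_of_pos (pow_pos hNpos' 2),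
    div_le_div_iff₀ (pow_pos hNpos' 2) (by positivity)]
  calc |N'| * (25 * ((k : ℝ) + 1)) ^ 3 = |N'| * (25 * ((k : ℝ) + 1)) * (25 * ((k : ℝ) + 1)) ^ 2 := by
        ring
    _ ≤ 12 * focal k * N * N := mul_le_mul hNm hNpos (by positivity) h12
    _ = 12 * focal k * N ^ 2 := by ring

/-- **The potential decreases along the meridians, uniformly**: on the outer band
`d/ds g_k(Z_k(e, s)) ≤ −2`. [folklore] -/
theorem exists_hasDerivAt_planarPot_outerZ (he : ‖e‖ = 1) (hs : s ∈ outerBand k) :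
    ∃ d : ℝ, HasDerivAt (fun s : ℝ ↦ planarPot k (outerZ k e s)) d s ∧ d ≤ -2 := by
  have hs0 := outerBand_pos hs
  have hs1 := outerBand_lt_one hs
  obtain ⟨hT1, hT2⟩ := sqrt_one_sub_sq_bounds hs
  obtain ⟨hD1, hD2⟩ := one_sub_sqrt_mul_bounds he hs
  have hab := abs_le.1 (abs_focal_sub_le hs)
  have he1 := abs_le.1 (abs_apply_le_one_of_norm_eq_one he 1)
  have ha := focal_pos (k := k)
  have ha1 := lt_focal (k := k)
  have ha2 := focal_lt (k := k)
  -- the main term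
  have hmain := hasDerivAt_normSq_outerZ (k := k) he hs0 hs1
  set T := Real.sqrt (1 - s ^ 2) with hT
  set D := 1 - T * e 1 with hDdef
  set N' := 2 * focal k * (-drawRadius k * D - (focal k - drawRadius k * s) * (s * e 1 / T)) / D ^ 2
    with hN'
  -- `N' ≤ -(4/5) a C`
  have hN'le : N' ≤ -(4 / 5) * focal k * drawRadius k := by
    rw [hN', div_le_iff₀ (by positivity)]
    have hC := drawRadius_pos' (k := k)
    -- multiply the bracket by `T > 0`
    have hT0 : 0 < T := by linarith
    have key : (-drawRadius k * D - (focal k - drawRadius k * s) * (s * e 1 / T)) * T =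
        -drawRadius k * D * T - (focal k - drawRadius k * s) * (s * e 1) := by
      field_simp
    have h1 : -drawRadius k * D * T - (focal k - drawRadius k * s) * (s * e 1) ≤
        -(2 / 5) * drawRadius k * D ^ 2 * T := by
      have hDT : D * (1 - 2 / 5 * D) * T ≥ 1 / 2 * (2 / 5) * (1 / 3) := by
        have h2 : 2 / 5 ≤ 1 - 2 / 5 * D := by linarith
        calc D * (1 - 2 / 5 * D) * T ≥ 1 / 2 * (2 / 5) * T := by gcongr
          _ ≥ 1 / 2 * (2 / 5) * (1 / 3) := by gcongr
      have h3 : |(focal k - drawRadius k * s) * (s * e 1)| ≤ drawRadius k / 50 := by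
        rw [abs_mul, abs_mul]
        calc |focal k - drawRadius k * s| * (|s| * |e 1|) ≤ drawRadius k / 50 * (1 * 1) := by
              gcongr
              · exact abs_focal_sub_le hs
              · rw [abs_of_pos hs0]; exact hs1.le
              · exact abs_apply_le_one_of_norm_eq_one he 1
          _ = drawRadius k / 50 := by ring
      have h4 := (abs_le.1 h3).1
      nlinarith [mul_le_mul_of_nonneg_left hDT hC.le]
    have h5 : (-drawRadius k * D - (focal k - drawRadius k * s) * (s * e 1 / T)) ≤
        -(2 / 5) * drawRadius k * D ^ 2 := by
      have := h1
      rw [← key] at this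
      exact le_of_mul_le_mul_right (by linarith) hT0
    nlinarith [mul_le_mul_of_nonneg_left h5 (by positivity : (0:ℝ) ≤ 2 * focal k)]
  -- the hole terms
  choose d hd hdle using fun j : Fin k ↦ exists_hasDerivAt_inv_normSq_outerZ he hs j
  have hsum : HasDerivAt (fun s : ℝ ↦ ∑ j : Fin k, 1 / Complex.normSq (outerZ k e s - holeCentre k j))
      (∑ j : Fin k, d j) s := HasDerivAt.fun_sum fun j _ ↦ hd j
  have hsumle : ∑ j : Fin k, d j ≤ 1 / 10 := by
    have hk : (0 : ℝ) ≤ k := Nat.cast_nonneg k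
    have hterm : ∀ j : Fin k, d j ≤ 12 * focal k / (25 * ((k : ℝ) + 1)) ^ 3 := fun j ↦
      (le_abs_self _).trans (hdle j)
    calc ∑ j : Fin k, d j ≤ ∑ _j : Fin k, 12 * focal k / (25 * ((k : ℝ) + 1)) ^ 3 :=
          Finset.sum_le_sum fun j _ ↦ hterm j
      _ = k * (12 * focal k / (25 * ((k : ℝ) + 1)) ^ 3) := by
          rw [Finset.sum_const, Finset.card_univ, Fintype.card_fin, nsmul_eq_mul]
      _ ≤ 1 / 10 := by
          rw [mul_div_assoc', div_le_div_iff₀ (by positivity) (by positivity)]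
          nlinarith [mul_nonneg hk (sq_nonneg ((k : ℝ) + 1)), sq_nonneg ((k : ℝ) - 1),
            mul_nonneg hk hk]
  refine ⟨N' / bigRadius k ^ 2 + ∑ j : Fin k, d j, ?_, ?_⟩
  · have h := (hmain.div_const (bigRadius k ^ 2)).add hsum
    simp only [planarPot_eq_bigRadius]
    exact h
  · have hR := bigRadius_pos (k := k)
    have h1 : N' / bigRadius k ^ 2 ≤ -4 := by
      rw [div_le_iff₀ (by positivity)]
      unfold bigRadius drawRadius at *
      nlinarith [hN'le]
    linarith

/-! ## Smoothness of the meridian parametrisation -/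

/-- **`Z_k(e, s)` is smooth in `(e, s)`** on `{|e| ≤ 1} × (0, 1)`. [folklore] -/
theorem contDiffAt_outerZ {q : 𝔼 2 × ℝ} (he : ‖q.1‖ ≤ 1) (hs0 : 0 < q.2) (hs1 : q.2 < 1)
    {n : WithTop ℕ∞} : ContDiffAt ℝ n (fun p : 𝔼 2 × ℝ ↦ outerZ k p.1 p.2) q := by
  have he' : ∀ i : Fin 2, ContDiff ℝ n fun p : 𝔼 2 × ℝ ↦ p.1 i := fun i ↦
    (contDiff_euclidean.1 contDiff_fst i)
  have hsq : ContDiffAt ℝ n (fun p : 𝔼 2 × ℝ ↦ Real.sqrt (1 - p.2 ^ 2)) q := by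
    refine (contDiff_const.sub (contDiff_snd.pow 2)).contDiffAt.sqrt ?_
    nlinarith
  have hD : ContDiffAt ℝ n (fun p : 𝔼 2 × ℝ ↦ 1 - Real.sqrt (1 - p.2 ^ 2) * p.1 1) q :=
    contDiffAt_const.sub (hsq.mul (he' 1).contDiffAt)
  have hD0 : 1 - Real.sqrt (1 - q.2 ^ 2) * q.1 1 ≠ 0 := (one_sub_sqrt_mul_pos hs0 he).ne'
  have hre : ContDiffAt ℝ n (fun p : 𝔼 2 × ℝ ↦ (outerZ k p.1 p.2).re) q := by
    simp only [outerZ_re]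
    exact ((contDiffAt_const.mul contDiffAt_snd).div hD hD0).sub contDiffAt_const
  have him : ContDiffAt ℝ n (fun p : 𝔼 2 × ℝ ↦ (outerZ k p.1 p.2).im) q := by
    simp only [outerZ_im]
    exact ((contDiffAt_const.mul hsq).mul (he' 0).contDiffAt).div hD hD0
  have h := hre.prodMk him
  -- `ℂ ≃ ℝ × ℝ`
  have hc := Complex.equivRealProdCLM.symm.contDiff.comp_contDiffAt q h
  have hfun : (fun p : 𝔼 2 × ℝ ↦ outerZ k p.1 p.2) = Complex.equivRealProdCLM.symm ∘
      (fun p : 𝔼 2 × ℝ ↦ ((outerZ k p.1 p.2).re, (outerZ k p.1 p.2).im)) := by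
    funext p
    simp only [Function.comp_apply, Complex.equivRealProdCLM_symm_apply]
    apply Complex.ext
    · simp only [Complex.add_re, Complex.mul_re, Complex.ofReal_re, Complex.ofReal_im,
        Complex.I_re, Complex.I_im, mul_zero, zero_mul, sub_zero, add_zero]
    · simp only [Complex.add_im, Complex.mul_im, Complex.ofReal_re, Complex.ofReal_im,
        Complex.I_re, Complex.I_im, mul_zero, mul_one, zero_add, add_zero]
  rw [hfun]
  exact hc

end MMSW

end Literature.Topology.FourManifolds
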